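import Summits.BirchSwinnertonDyer.Rank1Residual.GaloisImage.LocalOneUnitsGaloisModP
import Literature.NumberTheory.GaloisRepresentations.LocalOneUnitsStructureProofs
import Literature.NumberTheory.GaloisRepresentations.PadicAlgebraOfLocalField
import Literature.NumberTheory.GaloisRepresentations.LocalField
import Mathlib.RingTheory.Filtration
import HarnessLib

/-!
# `U_2 / U_2^p ≅ 𝒪_E / p 𝒪_E` as Galois modules (counting through `U_2 ≃ ℤ_pⁿ`)
# (cell `b2b-bsdres`, team n1011, row T-EPC = Tate's local Euler–Poincaré characteristic; seat p04 GEN 7; stage B2)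

HONEST FRAMING (cell `b2b-bsdres`, run/shared/lean/b2b/bsd-rank1-residual/, verbatim in every
file): the goal of the cell is to DELETE the COMBINATION-SHAPED residual classes of the
Birch–Swinnerton-Dyer formula for ALL analytic-rank `≤ 1` elliptic curves over `ℚ` — "full BSD
formula for every rank `≤ 1` curve in class `C`" assembled STRICTLY from published theorems — so
that the rank-`≤ 1` remainder becomes exactly the CONSTRUCTION-SHAPED classes, which are TYPED
(missing-input `Prop`s), NOT attempted. This is not "finishing BSD". Team n1011 (N10 / N11, the
additive block X4 ∧ `p = 3`): research route; no claim beyond the stated classes; nothing is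
booked; no mark / label is changed by this file. Theorems only (no definition, no named fact, no
`sorry`); TOOL theorems on local fields.

## What

For a non-archimedean local field `E` of characteristic `0` with `|p| < 1`:

* `OneUnits.integer_hypotheses` — the valuation ring `𝒪_E` satisfies the hypotheses of the tree's
  structure theorem `OneUnits.exists_subgroup_continuousMulEquiv` (`p` is a non-zero-divisor in
  the Jacobson radical, `p^m 𝒪_E` is open, `⋂ p^m 𝒪_E = 0`);
* `OneUnits.natCard_quotient_two_eq` — transporting `U_2(𝒪_E) ≃ ℤ_pⁿ` (`p^n = #(𝒪_E/p)`) to the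
  subgroup `U_2 ≤ Eˣ` of stage B1: `#(U_2 / U_2^p) = #(𝒪_E / p 𝒪_E)`, both finite;
* `OneUnits.nonempty_equiv_modP_two` — hence the digit map (stage B1, `OneUnits.exists_digitHom`:
  `U_2 ↠ 𝒪_E/p`, kernel `U_3 ⊇ U_2^p`) induces an EQUIVALENCE of `Gal(E/K)`-representations
  `U_2/U_2^p ≃ 𝒪_E/p𝒪_E` — the log-free form of "`[U^{(p)}] − [U_p] = [R_L^{(p)}]`" in Milne's
  proof of *ADT* I Thm. 2.8 (with Lemma 2.12 for `U ⊇ U_2`, stages A2–A3).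

References: J.-P. Serre, *Local Fields* (GTM 67), IV §2 Prop. 6, §3 Prop. 9; XIV §4
[SerreLocalFields1979]; J. Neukirch, *Algebraic Number Theory*, II (5.7) (i); J. S. Milne,
*Arithmetic Duality Theorems* (2006), I §2, proof of Thm. 2.8 [MilneADT2006].
-/

noncomputable section

open Function
open scoped ValuativeRel Topology

namespace Summit.BirchSwinnertonDyer.Rank1Residual.GaloisImage

namespace OneUnits

open Representation

variable {K : Type*} [Field K] {E : Type*} [Field E] [Algebra K E] [ValuativeRel E]
  [TopologicalSpace E] [IsNonarchimedeanLocalField E]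
variable (p : ℕ) [hp : Fact p.Prime]

/-! ### The valuation ring of a local field is a compact `p`-adic ring -/

section Hypotheses

omit hp [TopologicalSpace E] [IsNonarchimedeanLocalField E] in
/-- `a ∈ p^m 𝒪_E` whenever `v(a) ≤ v(p^m)` (`p ≠ 0`). [folklore] -/
theorem mem_span_pow_of_valuation_le [CharZero E] (hp0 : p ≠ 0) (m : ℕ) (a : 𝒪[E])
    (ha : ValuativeRel.valuation E (a : E) ≤ ValuativeRel.valuation E ((p : E) ^ m)) :
    a ∈ Ideal.span {((p : 𝒪[E]) ^ m)} := by
  have hpm : ((p : E) ^ m) ≠ 0 := pow_ne_zero _ (Nat.cast_ne_zero.2 hp0)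
  have hq : (a : E) / (p : E) ^ m ∈ 𝒪[E] := by
    rw [Valuation.mem_integer_iff, map_div₀]
    exact div_le_one_of_le₀ ha zero_le
  refine Ideal.mem_span_singleton'.2 ⟨⟨_, hq⟩, Subtype.ext ?_⟩
  simp only [Subring.coe_mul, Subring.coe_pow, Subring.coe_natCast]
  exact div_mul_cancel₀ _ hpm

/-- **`𝒪_E` is a compact `p`-adic ring** in the sense of `OneUnits.exists_subgroup_continuousMulEquiv`:
`p` is a non-zero-divisor, `1 + p a` is a unit, the ideals `p^m 𝒪_E` are open and
`⋂ₘ p^m 𝒪_E = 0` (Krull). [folklore] -/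
theorem integer_hypotheses [CharZero E] (hpv : ValuativeRel.valuation E p < 1) :
    (∀ a : 𝒪[E], (p : 𝒪[E]) * a = 0 → a = 0) ∧
    (∀ a : 𝒪[E], IsUnit (1 + (p : 𝒪[E]) * a)) ∧
    (∀ m : ℕ, IsOpen ((Ideal.span {((p : 𝒪[E]) ^ m)} : Ideal 𝒪[E]) : Set 𝒪[E])) ∧
    (∀ a : 𝒪[E], (∀ m : ℕ, a ∈ Ideal.span {((p : 𝒪[E]) ^ m)}) → a = 0) := by
  have hp0 : p ≠ 0 := hp.out.ne_zero
  have hpE : (p : E) ≠ 0 := Nat.cast_ne_zero.2 hp0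
  refine ⟨fun a ha => ?_, fun a => ?_, fun m => ?_, fun a ha => ?_⟩
  · have h' : (p : E) * (a : E) = 0 := by
      have := congrArg (Subtype.val : 𝒪[E] → E) ha
      simpa using this
    rcases mul_eq_zero.1 h' with h | h
    · exact absurd h hpE
    · exact Subtype.ext h
  · refine (Valuation.integer.integers (ValuativeRel.valuation E)).isUnit_of_one' ?_
    change ValuativeRel.valuation E ((1 + (p : 𝒪[E]) * a : 𝒪[E]) : E) = 1
    simp only [Subring.coe_add, Subring.coe_one, Subring.coe_mul, Subring.coe_natCast]
    have := valuation_one_add_eq_one p hpv le_rfl a.2 (E := E)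
    rwa [pow_one] at this
  · -- `p^m 𝒪_E` contains the neighbourhood `{a | v(a) < v(p^m)}` of `0`
    refine AddSubgroup.isOpen_of_mem_nhds (Ideal.span {((p : 𝒪[E]) ^ m)}).toAddSubgroup
      (g := 0) ?_
    have hγ0 : ValuativeRel.valuation E ((p : E) ^ m) ≠ 0 :=
      (Valuation.ne_zero_iff _).2 (pow_ne_zero _ hpE)
    have hmem : {z : E | ValuativeRel.valuation E z < Units.mk0 _ hγ0} ∈ 𝓝 (0 : E) :=
      (IsValuativeTopology.mem_nhds_zero_iff _).2 ⟨Units.mk0 _ hγ0, subset_rfl⟩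
    have hmem' : Subtype.val ⁻¹' {z : E | ValuativeRel.valuation E z < Units.mk0 _ hγ0} ∈
        𝓝 (0 : 𝒪[E]) := by
      rw [nhds_subtype]
      exact Filter.preimage_mem_comap (by simpa using hmem)
    refine Filter.mem_of_superset hmem' fun a ha => ?_
    exact mem_span_pow_of_valuation_le p hp0 m a (le_of_lt ha)
  · have hle : Ideal.span {(p : 𝒪[E])} ≤ 𝓂[E] := by
      rw [Ideal.span_le, Set.singleton_subset_iff]
      exact Literature.NumberTheory.GaloisRepresentations.LocalField.natCast_mem_maximalIdeal hpv
    have hinf := Ideal.iInf_pow_eq_bot_of_isLocalRing (I := 𝓂[E]) (IsLocalRing.maximalIdeal.isMaximal _).ne_top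
    have hmem : a ∈ ⨅ m : ℕ, 𝓂[E] ^ m := by
      refine Ideal.mem_iInf.2 fun m => ?_
      have h1 : a ∈ Ideal.span {(p : 𝒪[E])} ^ m := by rw [Ideal.span_singleton_pow]; exact ha m
      exact Ideal.pow_right_mono hle m h1
    rw [hinf] at hmem
    exact (Submodule.mem_bot _).1 hmem

end Hypotheses

/-! ### Counting `(ℤ_pⁿ) / p` -/

section PadicCount

omit hp in
/-- `#((ℤ_p)ⁿ / p (ℤ_p)ⁿ) = pⁿ` (`ℤ_p / p = ℤ/p`, Mathlib `PadicInt.toZMod`). [folklore] -/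
theorem natCard_quotient_pi_padicInt [Fact p.Prime] (n : ℕ) :
    Nat.card ((Fin n → ℤ_[p]) ⧸ LinearMap.range (LinearMap.lsmul ℤ (Fin n → ℤ_[p]) p)) = p ^ n := by
  classical
  let Φ : (Fin n → ℤ_[p]) →+ (Fin n → ZMod p) :=
    { toFun := fun x i => PadicInt.toZMod (x i)
      map_zero' := by ext i; simp
      map_add' := fun x y => by ext i; simp }
  have hΦ : Surjective Φ := fun y => by
    choose x hx using fun i => ZMod.ringHom_surjective (PadicInt.toZMod (p := p)) (y i)
    exact ⟨x, funext hx⟩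
  let Φℤ : (Fin n → ℤ_[p]) →ₗ[ℤ] (Fin n → ZMod p) := Φ.toIntLinearMap
  have hker : LinearMap.range (LinearMap.lsmul ℤ (Fin n → ℤ_[p]) p) = LinearMap.ker Φℤ := by
    ext x
    simp only [LinearMap.mem_range, LinearMap.lsmul_apply, LinearMap.mem_ker]
    constructor
    · rintro ⟨y, rfl⟩
      ext i
      change PadicInt.toZMod (((p : ℤ) • y) i) = 0
      rw [Pi.smul_apply, zsmul_eq_mul, Int.cast_natCast, map_mul, map_natCast, ZMod.natCast_self,
        zero_mul]
    · intro hx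
      have hi : ∀ i, x i ∈ Ideal.span {(p : ℤ_[p])} := fun i => by
        rw [← PadicInt.maximalIdeal_eq_span_p, ← PadicInt.ker_toZMod, RingHom.mem_ker]
        exact congrFun hx i
      choose y hy using fun i => Ideal.mem_span_singleton'.1 (hi i)
      refine ⟨y, funext fun i => ?_⟩
      rw [Pi.smul_apply, zsmul_eq_mul, Int.cast_natCast, mul_comm]
      exact hy i
  rw [Nat.card_congr ((Submodule.quotEquivOfEq _ _ hker).trans (Φℤ.quotKerEquivOfSurjective hΦ)).toEquiv,
    Nat.card_fun, Nat.card_zmod, Nat.card_eq_fintype_card, Fintype.card_fin]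

end PadicCount

/-! ### `#(U_2 / U_2^p) = #(𝒪_E / p)` -/

section Count

omit hp [TopologicalSpace E] [IsNonarchimedeanLocalField E] in
/-- A `ℤ`-linear equivalence carries `p M` onto `p M'`. [folklore] -/
theorem map_range_lsmul_eq {M M' : Type*} [AddCommGroup M] [AddCommGroup M'] (e : M ≃ₗ[ℤ] M') :
    Submodule.map e.toLinearMap (LinearMap.range (LinearMap.lsmul ℤ M p)) =
      LinearMap.range (LinearMap.lsmul ℤ M' p) := by
  ext x
  simp only [Submodule.mem_map, LinearMap.mem_range, LinearMap.lsmul_apply]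
  constructor
  · rintro ⟨_, ⟨v, rfl⟩, rfl⟩
    exact ⟨e v, (map_smul e.toLinearMap (p : ℤ) v).symm⟩
  · rintro ⟨v', rfl⟩
    refine ⟨(p : ℤ) • e.symm v', ⟨_, rfl⟩, ?_⟩
    rw [map_smul]
    exact congrArg _ (e.apply_symm_apply v')

/-- **`#(U_2 / U_2^p) = #(𝒪_E / p 𝒪_E)`** for the one-units of level `2` of `Eˣ`: transport of the
tree's structure theorem `U_2(𝒪_E) ≃ ℤ_pⁿ`, `pⁿ = #(𝒪_E/p)`
(`OneUnits.exists_subgroup_continuousMulEquiv`) along `𝒪_Eˣ ↪ Eˣ`, and `#(ℤ_pⁿ/p) = pⁿ`.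
[cite: SerreLocalFields1979, XIV §4 Prop. 10] -/
theorem natCard_quotient_two_eq [CharZero E] (hpv : ValuativeRel.valuation E p < 1)
    (U₂ : Submodule ℤ (Additive Eˣ))
    (hU₂ : ∀ u : Additive Eˣ, u ∈ U₂ ↔ ∃ b ∈ 𝒪[E], ((Additive.toMul u : Eˣ) : E) = 1 + (p : E) ^ 2 * b) :
    Nat.card (U₂ ⧸ LinearMap.range (LinearMap.lsmul ℤ U₂ p)) =
      Nat.card (𝒪[E] ⧸ Ideal.span {(p : 𝒪[E])}) ∧
    Finite (𝒪[E] ⧸ Ideal.span {(p : 𝒪[E])}) := by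
  classical
  haveI : T2Space E :=
    (Literature.NumberTheory.GaloisRepresentations.IsNonarchimedeanLocalField.isLocalField E).toT2Space
  obtain ⟨hreg, hunit, hopen, hsep⟩ := integer_hypotheses p hpv (E := E)
  obtain ⟨n, W, hcard, hW, -, -, ⟨eW⟩⟩ :=
    Literature.NumberTheory.GaloisRepresentations.OneUnits.exists_subgroup_continuousMulEquiv p
      (A := 𝒪[E]) hreg hunit hopen hsep
  -- `U₂ ≃+ Additive W`
  have hval : ∀ u : U₂, ((Additive.toMul (u : Additive Eˣ) : Eˣ) : E) ∈ 𝒪[E] ∧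
      (((Additive.toMul (u : Additive Eˣ) : Eˣ)⁻¹ : Eˣ) : E) ∈ 𝒪[E] := fun u => by
    obtain ⟨b, hb, hub⟩ := (hU₂ u).1 u.2
    refine ⟨?_, inv_mem_integer p hpv (by norm_num : 1 ≤ 2) hb hub⟩
    rw [Valuation.mem_integer_iff, hub, valuation_one_add_eq_one p hpv (by norm_num : 1 ≤ 2) hb]
  let toO : U₂ → (𝒪[E])ˣ := fun u =>
    ⟨⟨_, (hval u).1⟩, ⟨_, (hval u).2⟩, Subtype.ext (Units.mul_inv _), Subtype.ext (Units.inv_mul _)⟩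
  have htoO : ∀ u : U₂, (((toO u : (𝒪[E])ˣ) : 𝒪[E]) : E) = ((Additive.toMul (u : Additive Eˣ) : Eˣ) : E) :=
    fun u => rfl
  have hmemW : ∀ u : U₂, toO u ∈ W := fun u => by
    obtain ⟨b, hb, hub⟩ := (hU₂ u).1 u.2
    exact (hW _).2 ⟨⟨b, hb⟩, Subtype.ext (by
      simp only [Subring.coe_add, Subring.coe_one, Subring.coe_mul, Subring.coe_pow, Subring.coe_natCast]
      exact hub)⟩
  let f : U₂ → Additive W := fun u => Additive.ofMul ⟨toO u, hmemW u⟩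
  have hf_val : ∀ u : U₂, ((((Additive.toMul (f u) : W) : (𝒪[E])ˣ) : 𝒪[E]) : E) =
      ((Additive.toMul (u : Additive Eˣ) : Eˣ) : E) := fun u => rfl
  -- inverse direction
  have hmemU : ∀ x : W, Additive.ofMul (Units.map (𝒪[E]).subtype.toMonoidHom (x : (𝒪[E])ˣ)) ∈ U₂ :=
    fun x => by
    obtain ⟨b, hb⟩ := (hW x).1 x.2
    refine (hU₂ _).2 ⟨(b : E), b.2, ?_⟩
    have h := congrArg (Subtype.val : 𝒪[E] → E) hb
    simp only [Subring.coe_add, Subring.coe_one, Subring.coe_mul, Subring.coe_pow,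
      Subring.coe_natCast] at h
    exact h
  let g : Additive W → U₂ := fun x => ⟨_, hmemU (Additive.toMul x)⟩
  have e₁ : U₂ ≃+ Additive W :=
    { toFun := f
      invFun := g
      left_inv := fun u => Subtype.ext rfl
      right_inv := fun x => by
        refine congrArg Additive.ofMul (Subtype.ext (Units.ext (Subtype.ext rfl)))
      map_add' := fun u w => by
        refine congrArg Additive.ofMul (Subtype.ext (Units.ext (Subtype.ext ?_)))
        change ((Additive.toMul ((u + w : U₂) : Additive Eˣ) : Eˣ) : E) =
          ((Additive.toMul (u : Additive Eˣ) : Eˣ) : E) * ((Additive.toMul (w : Additive Eˣ) : Eˣ) : E)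
        rw [Submodule.coe_add, toMul_add, Units.val_mul] }
  -- `U₂ ≃+ (Fin n → ℤ_[p])`
  let e₂ : U₂ ≃+ (Fin n → ℤ_[p]) :=
    (e₁.trans (MulEquiv.toAdditive eW.toMulEquiv)).trans (AddEquiv.additiveMultiplicative _)
  let e₃ : U₂ ≃ₗ[ℤ] (Fin n → ℤ_[p]) := e₂.toIntLinearEquiv
  have hq := Nat.card_congr (Submodule.Quotient.equiv (LinearMap.range (LinearMap.lsmul ℤ U₂ p))
    (LinearMap.range (LinearMap.lsmul ℤ (Fin n → ℤ_[p]) p)) e₃ (map_range_lsmul_eq p e₃)).toEquiv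
  rw [natCard_quotient_pi_padicInt] at hq
  refine ⟨hq.trans hcard.symm, Nat.finite_of_card_ne_zero ?_⟩
  rw [hcard]; exact pow_ne_zero _ hp.out.ne_zero

end Count

/-! ### `U_2 / U_2^p ≃ 𝒪_E / p 𝒪_E` as `Gal(E/K)`-representations -/

section Equiv

omit hp [TopologicalSpace E] [IsNonarchimedeanLocalField E] in
/-- `#(O/pO) = #(𝒪_E/(p))` for the `ℤ`-submodule copy `O` of `𝒪_E` in `E`. [folklore] -/
theorem natCard_quotient_integer_eq (O : Submodule ℤ E) (hO : ∀ x, x ∈ O ↔ x ∈ 𝒪[E]) :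
    Nat.card (O ⧸ LinearMap.range (LinearMap.lsmul ℤ O p)) =
      Nat.card (𝒪[E] ⧸ Ideal.span {(p : 𝒪[E])}) := by
  let e : O ≃+ 𝒪[E] :=
    { toFun := fun x => ⟨x.1, (hO _).1 x.2⟩
      invFun := fun y => ⟨y.1, (hO _).2 y.2⟩
      left_inv := fun x => rfl
      right_inv := fun y => rfl
      map_add' := fun x y => rfl }
  have hmap : AddSubgroup.map e.toAddMonoidHom (LinearMap.range (LinearMap.lsmul ℤ O p)).toAddSubgroup =
      (Ideal.span {(p : 𝒪[E])}).toAddSubgroup := by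
    ext y
    simp only [AddSubgroup.mem_map, Submodule.mem_toAddSubgroup, LinearMap.mem_range,
      LinearMap.lsmul_apply, AddEquiv.coe_toAddMonoidHom]
    constructor
    · rintro ⟨_, ⟨z, rfl⟩, rfl⟩
      refine Ideal.mem_span_singleton'.2 ⟨e z, Subtype.ext ?_⟩
      change ((e z : 𝒪[E]) : E) * (p : E) = (((p : ℤ) • z : O) : E)
      rw [Submodule.coe_smul_of_tower, zsmul_eq_mul, Int.cast_natCast, mul_comm]; rfl
    · intro hy
      obtain ⟨a, ha⟩ := Ideal.mem_span_singleton'.1 hy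
      refine ⟨(p : ℤ) • e.symm a, ⟨e.symm a, rfl⟩, Subtype.ext ?_⟩
      change (((p : ℤ) • e.symm a : O) : E) = (y : E)
      rw [Submodule.coe_smul_of_tower, zsmul_eq_mul, Int.cast_natCast, ← ha, Subring.coe_mul,
        Subring.coe_natCast, mul_comm]; rfl
  exact Nat.card_congr (QuotientAddGroup.congr _ _ e hmap).toEquiv

/-- **`U_2 / U_2^p ≃ 𝒪_E / p 𝒪_E` as `Gal(E/K)`-representations**: the digit map
`1 + p² b ↦ b mod p` (`OneUnits.exists_digitHom`; kernel `U_3 ⊇ U_2^p`) induces a surjection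
`U_2/U_2^p → 𝒪_E/p𝒪_E` between finite groups of the same order
(`natCard_quotient_two_eq`), hence an equivalence.  This is "`[U^{(p)}] − [U_p] = [R_L^{(p)}]`"
of Milne's proof of *ADT* I Thm. 2.8 at the level `U_2` (no `p`-torsion), without the exponential.
[cite: MilneADT2006, I §2 (proof of Thm. 2.8)] [cite: SerreLocalFields1979, IV §2 Prop. 6] -/
theorem nonempty_equiv_modP_two [CharZero E] (hpv : ValuativeRel.valuation E p < 1)
    (U₂ U₃ : Submodule ℤ (Additive Eˣ))
    (hU₂ : ∀ u : Additive Eˣ, u ∈ U₂ ↔ ∃ b ∈ 𝒪[E], ((Additive.toMul u : Eˣ) : E) = 1 + (p : E) ^ 2 * b)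
    (hU₃ : ∀ u : Additive Eˣ, u ∈ U₃ ↔ ∃ b ∈ 𝒪[E], ((Additive.toMul u : Eˣ) : E) = 1 + (p : E) ^ 3 * b)
    (hU₂st : ∀ σ, U₂ ≤ U₂.comap (Representation.ofMulDistribMulAction (E ≃ₐ[K] E) Eˣ σ))
    (O : Submodule ℤ E) (hO : ∀ x, x ∈ O ↔ x ∈ 𝒪[E])
    (hOst : ∀ σ, O ≤ O.comap (Representation.ofDistribMulAction ℤ (E ≃ₐ[K] E) E σ)) :
    Nonempty ((((Representation.ofMulDistribMulAction (E ≃ₐ[K] E) Eˣ).subrepresentation U₂ hU₂st).quotient _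
        (ModPRepCount.range_lsmul_le_comap
          ((Representation.ofMulDistribMulAction (E ≃ₐ[K] E) Eˣ).subrepresentation U₂ hU₂st) p)).Equiv
      ((((Representation.ofDistribMulAction ℤ (E ≃ₐ[K] E) E).subrepresentation O hOst).quotient _
        (ModPRepCount.range_lsmul_le_comap
          ((Representation.ofDistribMulAction ℤ (E ≃ₐ[K] E) E).subrepresentation O hOst) p)))) := by
  classical
  have hp0 : (p : E) ≠ 0 := Nat.cast_ne_zero.2 hp.out.ne_zero
  obtain ⟨φ, hsurj, hker⟩ := exists_digitHom p hpv hp0 U₂ U₃ hU₂ hU₃ hU₂st O hO hOst (K := K)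
  -- `p U₂ ≤ ker φ` (`U_2^p ≤ U_3`)
  have hle : LinearMap.range (LinearMap.lsmul ℤ U₂ p) ≤ LinearMap.ker φ.toLinearMap := by
    rintro _ ⟨u, rfl⟩
    rw [LinearMap.mem_ker]
    change φ ((p : ℤ) • u) = 0
    rw [hker, Submodule.coe_smul_of_tower, natCast_zsmul]
    exact nsmul_mem_succ p hpv (by norm_num : 1 ≤ 2) U₂ U₃ hU₂ hU₃ u.2
  let φbar := (LinearMap.range (LinearMap.lsmul ℤ U₂ p)).liftQ φ.toLinearMap hle
  have hφbar : ∀ u : U₂, φbar (Submodule.Quotient.mk u) = φ u := fun u => rfl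
  have hsurj' : Surjective φbar := fun y => by
    obtain ⟨u, rfl⟩ := hsurj y
    exact ⟨Submodule.Quotient.mk u, hφbar u⟩
  -- counting
  obtain ⟨hcardU, hfin⟩ := natCard_quotient_two_eq p hpv U₂ hU₂ (E := E)
  have hcardO := natCard_quotient_integer_eq p O hO (E := E)
  haveI : Finite (U₂ ⧸ LinearMap.range (LinearMap.lsmul ℤ U₂ p)) := by
    refine Nat.finite_of_card_ne_zero ?_
    rw [hcardU]
    haveI := hfin
    exact Nat.card_pos.ne'
  have hbij : Bijective φbar :=
    (Nat.bijective_iff_surjective_and_card _).2 ⟨hsurj', by rw [hcardU, ← hcardO]⟩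
  refine ⟨Representation.Equiv.mk (LinearEquiv.ofBijective φbar hbij) fun σ => LinearMap.ext fun x => ?_⟩
  obtain ⟨u, rfl⟩ := Submodule.mkQ_surjective _ x
  exact (hφbar _).trans ((IntertwiningMap.isIntertwining _ _ φ σ u).trans (congrArg _ (hφbar u).symm))

end Equiv

end OneUnits

end Summit.BirchSwinnertonDyer.Rank1Residual.GaloisImage

end
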